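import Mathlib
import HarnessLib
import Summits.QuantumFields.YangMills.Theses.ScalingWindowSplit
import Summits.QuantumFields.YangMills.Cruxes.SelfNormalisedMomentBoundsR.MaskedSectorObstruction

/-!
# Crux `SelfNormalisedMomentBoundsR` (stmt-QuantumFields-18014) — ideator 2, round 1: `Sketch.lean`

First lemmas of the crux idea **`scale-local-normalisation`** ("normalise each Whitney piece at its own
scale").  Contents (all over existing declarations; nothing here restates or weakens the crux):

* `shrink μ` — the test-function dilation `(shrink μ f)(x) = f (μ • x)` (support shrunk by `1/μ`), Mathlib
  `SchwartzMap.compCLMOfContinuousLinearEquiv` (pattern of the tree's `blockDilate`).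
* `SpeciesScheme.dilate sch μ` — the SAME lattice measures read with spacing `μ a_k` (zoom by `μ`): `β`, `L`,
  `c`, `m` unchanged.  Constructible for every fixed `μ > 0` because `SpeciesScheme` only asks `a_k → 0`,
  `a_k L_k → ∞`.
* `smearedLatticeField_dilate` (PROVED): the exact scale covariance
  `Φ_{μa}(f) = μ⁴ · Φ_a(shrink μ f)` of the tree's smeared field — the algebraic heart of the lever: the
  `∀`-scheme crux is closed under zooms, and zooming costs only the ratio of self-normalisers.
* `RefMonotoneAt` / `RefMonotoneS` — the `n = 2` piece (β): shrinking the reference reflected pair toward the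
  hyperplane never gains more than a constant, `|T⁰_k(S_μ u, θ S_μ u)| ≤ B · T⁰_k(u, θu)` for all `μ ≥ 1`,
  `k ≥ k₀` (asymptotic freedom read on `tr F²`: `r⁸ C(r)` quasi-non-decreasing below the reference scale;
  FALSE for the masked product group `U(1) × SU(2)` of `MaskedSectorObstruction`, which is why it carries
  `IsCompactSimpleLieGroup`).
* `ScaleLocalBoundsAt` / `ScaleLocalBoundsS` — the phase-cell piece (α): hierarchically separated
  multi-resolution bumps, EACH self-normalised at ITS OWN scale `ℓᵢ` by `c'(ℓᵢ) = 1/√T⁰(S_{1/ℓᵢ}u, θS_{1/ℓᵢ}u)`,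
  have joint moments `≤ C₀ C₁ⁿ n! ∏ Aᵢ` (amplitudes only — no Schwartz flatness, no fixed normalisation scale).
* `AssemblyShapeS` / `AssemblyShapeR` — the shape of the line's composition (β) → (α) → U_RS (resp. U_R by
  name with the all-`G` versions, whose (β)-stub is the false one): the Whitney/phase-cell assembly, to be
  PROVED by the crux-plan (analysis: Whitney cubes relative to the other supports, Taylor flatness
  `A_{i,Q} ≤ ℓ_Q^s`, multilinearity, `Σ_Q A_{i,Q} < ∞`, and `c'(1)/c'(ℓ) ≤ √B` from (β)).

No `sorry`: the identities (`smearedLatticeField_dilate`, `latticeSchwinger_dilate`, `trunc_dilate`,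
`thetaTest_shrink`) are proved; (β), (α) and the assembly shapes are `def … : Prop` statements.
-/

noncomputable section

open scoped SchwartzMap BigOperators Topology
open MeasureTheory Filter Topology
open Literature.MathematicalPhysics.AQFT Literature.MathematicalPhysics.QuantumLattice
open Literature.MathematicalPhysics.QuantumFieldTheory

namespace Summit.QuantumFields.YangMills.Cruxes.SelfNormalisedMomentBoundsR.ScaleLocal

/-! ## Dilations of test functions and of schemes -/

/-- `shrink μ f = f ∘ (μ • ·)`: the test function with support shrunk by the factor `1/μ` (junk: identity at
`μ = 0`). [folklore] -/
def shrink (μ : ℝ) : 𝓢(EuclideanSpace ℝ (Fin 4), ℝ) →L[ℝ] 𝓢(EuclideanSpace ℝ (Fin 4), ℝ) :=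
  if hμ : μ = 0 then ContinuousLinearMap.id ℝ _
  else SchwartzMap.compCLMOfContinuousLinearEquiv ℝ
    ((LinearEquiv.smulOfNeZero ℝ (EuclideanSpace ℝ (Fin 4)) μ hμ).toContinuousLinearEquiv)

@[simp] theorem shrink_apply {μ : ℝ} (hμ : μ ≠ 0) (f : 𝓢(EuclideanSpace ℝ (Fin 4), ℝ))
    (x : EuclideanSpace ℝ (Fin 4)) : shrink μ f x = f (μ • x) := by
  simp only [shrink, hμ, ↓reduceDIte, SchwartzMap.compCLMOfContinuousLinearEquiv_apply,
    Function.comp_apply, LinearEquiv.coe_toContinuousLinearEquiv', LinearEquiv.smulOfNeZero_apply]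

/-- **The dilated scheme** `sch.dilate μ`: the same tori, couplings and renormalisation constants, lattice
spacing `μ a_k` — physical distance `1` of the dilated scheme is physical distance `1/μ` of `sch` (zoom INTO the
ultraviolet for `μ > 1`). [folklore] -/
def _root_.Literature.MathematicalPhysics.QuantumFieldTheory.SpeciesScheme.dilate {ι : Type}
    (sch : SpeciesScheme ι) (μ : ℝ) (hμ : 0 < μ) : SpeciesScheme ι where
  a := fun k => μ * sch.a k
  a_pos := fun k => mul_pos hμ (sch.a_pos k)
  tendsto_a := by simpa using sch.tendsto_a.const_mul μ
  β := sch.β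
  L := sch.L
  tendsto_L := by
    have h : (fun k => μ * sch.a k * (sch.L k : ℝ)) = fun k => μ * (sch.a k * (sch.L k : ℝ)) := by
      funext k; ring
    rw [h]
    exact sch.tendsto_L.const_mul_atTop hμ
  c := sch.c
  m := sch.m

section Identity

variable {G : Type} [MeasurableSpace G]

/-- **Exact scale covariance of the smeared lattice field**: reading the SAME configuration with spacing
`μ a` is the same as shrinking the test function by `μ`, up to the Jacobian `μ⁴`:
`Φ_{μa}(f) = μ⁴ Φ_a(f ∘ (μ • ·))`.  (The law of `U` never sees `a`.) [folklore] -/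
theorem smearedLatticeField_dilate (O : LGConfig 4 G → ℝ)
    (Λ : Finset (Literature.Probability.LatticeModels.Site 4)) (a c m μ : ℝ) (hμ : μ ≠ 0)
    (f : 𝓢(EuclideanSpace ℝ (Fin 4), ℝ)) (U : LGConfig 4 G) :
    smearedLatticeField O Λ (μ * a) c m f U = μ ^ 4 * smearedLatticeField O Λ a c m (shrink μ f) U := by
  simp only [smearedLatticeField, shrink_apply hμ, smul_smul]
  ring

end Identity

/-! ## The two pieces of the line and the assembly shape -/

section Pieces

variable {G : Type} [Group G] [TopologicalSpace G] [IsTopologicalGroup G] [CompactSpace G]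
  [MeasurableSpace G] [BorelSpace G]

/-- The crux's bare truncated reflected two-point datum `T⁰_k(w, θw)` of the curvature (verbatim the `let T`
of `SelfNormalisedMomentBoundsR`, as a definition). [folklore] -/
def trunc (r : LatticeRep G) (sch : SpeciesScheme (YMSpecies G))
    (w : 𝓢(EuclideanSpace ℝ (Fin 4), ℝ)) (k : ℕ) : ℝ :=
  let bare : SpeciesScheme (YMSpecies G) := { sch with c := fun _ _ => 1, m := fun _ _ => 0 }
  latticeSchwinger r.ρ bare (fun s => s.F) k (1 + 1) (fun _ => r.curvature) ![w, thetaTest 4 w] -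
    latticeSchwinger r.ρ bare (fun s => s.F) k 1 (fun _ => r.curvature) ![w] *
      latticeSchwinger r.ρ bare (fun s => s.F) k 1 (fun _ => r.curvature) ![thetaTest 4 w]

/-- The hypothesis block of U_R / U_RS at one datum `(r, sch, u, p, M)` (weak coupling, polynomial volumes,
past support, floor and window), verbatim. [folklore] -/
def Hyps (r : LatticeRep G) (sch : SpeciesScheme (YMSpecies G))
    (u : 𝓢(EuclideanSpace ℝ (Fin 4), ℝ)) (p : ℕ) (M : ℝ) : Prop :=
  sch.HasWeakCouplingLimit ∧
  (∃ N : ℕ, 1 ≤ N ∧ ∀ᶠ k in atTop, (sch.a k)⁻¹ ≤ (sch.a k * (sch.L k : ℝ)) ^ N) ∧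
  tsupport u ⊆ {y : EuclideanSpace ℝ (Fin 4) | y 0 < 0} ∧
  (∀ᶠ k in atTop, (sch.a k) ^ p ≤ trunc r sch u k ∧
    trunc r sch u k ≤ M * trunc r sch (timeShiftTest 4 (-1) u) k)

/-- **(β) `RefMonotone` at one datum** — the `n = 2`, one-parameter piece: shrinking the reference reflected
pair `(u, θu)` toward the hyperplane by any factor `μ ≥ 1` never gains more than a constant on the bare
truncated two-point function, eventually in `k` and UNIFORMLY in `μ`:
`|T⁰_k(S_μ u, θ S_μ u)| ≤ B · T⁰_k(u, θu)`.  Position-space form of "the Källén–Lehmann weight of `tr F²`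
grows at most canonically (`E⁸`) above the reference scale" = "`r⁸ C_k(r)` is quasi-non-decreasing in `r`
below the reference separation" = asymptotic freedom read on the composite operator (`r⁸C(r) ∝ g(r)⁴`).
For `μ ≫ 1/a_k` the shrunk pair meets no lattice point and `T⁰ = 0` (harmless). [folklore] -/
def RefMonotoneAt (r : LatticeRep G) (sch : SpeciesScheme (YMSpecies G))
    (u : 𝓢(EuclideanSpace ℝ (Fin 4), ℝ)) : Prop :=
  ∃ (B : ℝ) (k₀ : ℕ), ∀ μ : ℝ, 1 ≤ μ → ∀ k : ℕ, k₀ ≤ k →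
    |trunc r sch (shrink μ u) k| ≤ B * trunc r sch u k

/-- **(α) `ScaleLocalBounds` at one datum** — the phase-cell piece.  Pieces `i < n` at scales
`ℓᵢ ∈ (0, 1]` (reference units), amplitudes `Aᵢ ≥ 0`, centres `xᵢ`: each plane component `Fᵢ q` is supported
in the ball `B(xᵢ, ℓᵢ)` and is RESOLVED at scale `ℓᵢ` (`‖Dˡ Fᵢ q‖ ≤ Aᵢ ℓᵢ^{-l}`, `l ≤ s`); the supports are
HIERARCHICALLY separated (`dist ≥ max(ℓᵢ, ℓⱼ)`); and piece `i` is SELF-NORMALISED AT ITS OWN SCALE by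
`c'(ℓᵢ, k) = 1/√T⁰_k(S_{1/ℓᵢ} u, θ S_{1/ℓᵢ} u)` (the canon normaliser of the dilated scheme `sch.dilate ℓᵢ⁻¹`, up
to the Jacobian), centred by the torus mean per plane as in `canon`.  Conclusion: joint moments
`≤ C₀ C₁ⁿ n! ∏ Aᵢ`, eventually in `k`, uniformly in everything else — no Schwartz flatness and no fixed
normalisation scale appear.  Single-scale tuples at scale `ℓ` are (unit-resolved) U for the dilated scheme;
the new content is the mixed-scale case, where a dimension-4 field pays `(ℓ_</d)⁴` between scales. [folklore] -/
def ScaleLocalBoundsAt (r : LatticeRep G) (sch : SpeciesScheme (YMSpecies G))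
    (u : 𝓢(EuclideanSpace ℝ (Fin 4), ℝ)) : Prop :=
  ∃ (s : ℕ) (C₀ C₁ : ℝ) (k₀ : ℕ), ∀ (n : ℕ) (ℓ A : Fin n → ℝ) (x : Fin n → EuclideanSpace ℝ (Fin 4))
    (F : Fin n → {q : Fin 4 × Fin 4 // q.1 < q.2} → 𝓢(EuclideanSpace ℝ (Fin 4), ℝ)),
    (∀ i, 0 < ℓ i ∧ ℓ i ≤ 1) → (∀ i, 0 ≤ A i) →
    (∀ i q, tsupport (F i q) ⊆ Metric.closedBall (x i) (ℓ i)) →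
    (∀ i q (l : ℕ), l ≤ s → ∀ y, ‖iteratedFDeriv ℝ l (F i q) y‖ ≤ A i * ((ℓ i)⁻¹) ^ l) →
    (∀ i j, i ≠ j → ∀ q q', ∀ y ∈ tsupport (F i q), ∀ z ∈ tsupport (F j q'),
      max (ℓ i) (ℓ j) ≤ dist y z) →
    ∀ k : ℕ, k₀ ≤ k →
      |∫ U, ∏ i, ∑ q : {q : Fin 4 × Fin 4 // q.1 < q.2},
          smearedLatticeField (plaquetteObs r.ρ 0 q.1.1 q.1.2)
            (Literature.Probability.LatticeModels.box 4 (sch.L k)) (sch.a k)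
            ((Real.sqrt (trunc r sch (shrink (ℓ i)⁻¹ u) k))⁻¹)
            ((∫ V, r.curvature.F (torusLift (sch.side k) V) ∂(wilsonMeasure r.ρ (sch.β k))) / 6)
            (F i q) (torusLift (sch.side k) U)
        ∂(wilsonMeasure r.ρ (sch.β k) : Measure (GaugeConfig 4 (sch.side k) G))|
        ≤ C₀ * C₁ ^ n * n.factorial * ∏ i, A i

end Pieces

/-- **(β) for compact SIMPLE `G`** (the line's first stub; carries the whole group-dependence of U). [folklore] -/
def RefMonotoneS : Prop :=
  ∀ (G : Type) [Group G] [TopologicalSpace G] [IsTopologicalGroup G] [CompactSpace G]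
    [MeasurableSpace G] [BorelSpace G], IsCompactSimpleLieGroup G →
    ∀ (r : LatticeRep G) (sch : SpeciesScheme (YMSpecies G)) (u : 𝓢(EuclideanSpace ℝ (Fin 4), ℝ))
      (p : ℕ) (M : ℝ), Hyps r sch u p M → RefMonotoneAt r sch u

/-- **(α) for compact SIMPLE `G`** (the line's hard stub, phase-cell format). [folklore] -/
def ScaleLocalBoundsS : Prop :=
  ∀ (G : Type) [Group G] [TopologicalSpace G] [IsTopologicalGroup G] [CompactSpace G]
    [MeasurableSpace G] [BorelSpace G], IsCompactSimpleLieGroup G →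
    ∀ (r : LatticeRep G) (sch : SpeciesScheme (YMSpecies G)) (u : 𝓢(EuclideanSpace ℝ (Fin 4), ℝ))
      (p : ℕ) (M : ℝ), Hyps r sch u p M → ScaleLocalBoundsAt r sch u

/-- (β) for ALL compact `G` — typed only to exhibit where the masked-sector witness of
`MaskedSectorObstruction` bites a line concluding U_R BY NAME: this is its false-for-products stub. [folklore] -/
def RefMonotoneAll : Prop :=
  ∀ (G : Type) [Group G] [TopologicalSpace G] [IsTopologicalGroup G] [CompactSpace G]
    [MeasurableSpace G] [BorelSpace G],
    ∀ (r : LatticeRep G) (sch : SpeciesScheme (YMSpecies G)) (u : 𝓢(EuclideanSpace ℝ (Fin 4), ℝ))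
      (p : ℕ) (M : ℝ), Hyps r sch u p M → RefMonotoneAt r sch u

/-- (α) for ALL compact `G` (plausibly TRUE also for product groups: every piece is normalised at its own
scale, so a sector invisible at the reference but dominant below it is caught by the finer normaliser). [folklore] -/
def ScaleLocalBoundsAll : Prop :=
  ∀ (G : Type) [Group G] [TopologicalSpace G] [IsTopologicalGroup G] [CompactSpace G]
    [MeasurableSpace G] [BorelSpace G],
    ∀ (r : LatticeRep G) (sch : SpeciesScheme (YMSpecies G)) (u : 𝓢(EuclideanSpace ℝ (Fin 4), ℝ))
      (p : ℕ) (M : ℝ), Hyps r sch u p M → ScaleLocalBoundsAt r sch u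

/-- **Assembly shape (repaired crux).**  The crux-plan's composition theorem: (β) and (α) give U_RS by the
Whitney/phase-cell decomposition of a normalised disjoint tuple (Taylor flatness `A_{i,Q} ≤ ℓ_Q^s`,
multilinearity, `Σ_Q A_{i,Q} ≤ Σ_j 2^{-j(s-3)} < ∞`, and the exact rescaling
`c'(1) Φ = (c'(1)/c'(ℓ)) · Φ^{(ℓ)}` with `c'(1)/c'(ℓ) ≤ √B` from (β)); early `k < k₀` are absorbed by the
trivial per-`k` sup bound. A STATEMENT here (the proof is the line's provable stub). [folklore] -/
def AssemblyShapeS : Prop :=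
  RefMonotoneS → ScaleLocalBoundsS → Strategist.SelfNormalisedMomentBoundsRS

/-- **Assembly shape (crux by name).**  Same composition concluding U_R literally; its first binder
`RefMonotoneAll` is refuted modulo (P1)+(P2) by the masked sector — consistent with the census's "every
skeleton concluding U_R by name has a false stub", and locating that stub at `n = 2`. [folklore] -/
def AssemblyShapeR : Prop :=
  RefMonotoneAll → ScaleLocalBoundsAll →
    Summit.QuantumFields.YangMills.Theses.ScalingWindowSplit.SelfNormalisedMomentBoundsR

/-! ## Sanity lemmas -/

section Sanity

variable {G : Type} [Group G] [TopologicalSpace G] [IsTopologicalGroup G] [CompactSpace G]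
  [MeasurableSpace G] [BorelSpace G]

/-- The dilated scheme has the same tori. [folklore] -/
@[simp] theorem dilate_side {ι : Type} (sch : SpeciesScheme ι) (μ : ℝ) (hμ : 0 < μ) (k : ℕ) :
    (sch.dilate μ hμ).side k = sch.side k := rfl

/-- The dilated scheme has the same couplings. [folklore] -/
@[simp] theorem dilate_β {ι : Type} (sch : SpeciesScheme ι) (μ : ℝ) (hμ : 0 < μ) (k : ℕ) :
    (sch.dilate μ hμ).β k = sch.β k := rfl

/-- Weak coupling is dilation-invariant (it reads `β` only). [folklore] -/
theorem hasWeakCouplingLimit_dilate {ι : Type} (sch : SpeciesScheme ι) (μ : ℝ) (hμ : 0 < μ) :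
    (sch.dilate μ hμ).HasWeakCouplingLimit ↔ sch.HasWeakCouplingLimit := Iff.rfl

/-- `θ` commutes with `shrink` (time reflection is linear). [folklore] -/
theorem thetaTest_shrink (μ : ℝ) (f : 𝓢(EuclideanSpace ℝ (Fin 4), ℝ)) :
    thetaTest 4 (shrink μ f) = shrink μ (thetaTest 4 f) := by
  by_cases hμ : μ = 0
  · simp [shrink, hμ]
  · ext x
    simp [shrink_apply hμ, map_smul]

/-- **Scale covariance of the lattice `n`-point functions**: the dilated scheme's `n`-point function at
`f` is `μ^{4n}` times the original scheme's at the shrunk tests. [folklore] -/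
theorem latticeSchwinger_dilate {N : ℕ} {ι : Type} (ρ : G →* Matrix (Fin N) (Fin N) ℂ)
    (sch : SpeciesScheme ι) (μ : ℝ) (hμ : 0 < μ) (obs : ι → LGConfig 4 G → ℝ) (k n : ℕ)
    (σ : Fin n → ι) (f : Fin n → 𝓢(EuclideanSpace ℝ (Fin 4), ℝ)) :
    latticeSchwinger ρ (sch.dilate μ hμ) obs k n σ f =
      μ ^ (4 * n) * latticeSchwinger ρ sch obs k n σ (fun i => shrink μ (f i)) := by
  have hμ0 : μ ≠ 0 := hμ.ne'
  unfold latticeSchwinger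
  rw [← integral_const_mul]
  refine integral_congr_ae (Filter.Eventually.of_forall fun U => ?_)
  change ∏ i, smearedLatticeField (obs (σ i)) (Literature.Probability.LatticeModels.box 4 (sch.L k))
      (μ * sch.a k) (sch.c (σ i) k) (sch.m (σ i) k) (f i) (torusLift (sch.side k) U) = _
  simp only [smearedLatticeField_dilate _ _ _ _ _ _ hμ0, Finset.prod_mul_distrib, Finset.prod_const,
    Finset.card_univ, Fintype.card_fin, ← pow_mul]

/-- **Scale covariance of the reference datum**: `T⁰` of the dilated scheme at `w` is `μ⁸ T⁰` of the scheme at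
`shrink μ w` — so the canon normaliser of `sch.dilate μ` is `μ⁻⁴ / √T⁰(S_μ u, θ S_μ u)`, and RATIOS of
self-normalised quantities along the dilation orbit are governed by `T⁰(S_μ u, θS_μ u)/T⁰(u, θu)` alone
(the quantity (β) bounds). [folklore] -/
theorem trunc_dilate (r : LatticeRep G) (sch : SpeciesScheme (YMSpecies G)) (μ : ℝ) (hμ : 0 < μ)
    (w : 𝓢(EuclideanSpace ℝ (Fin 4), ℝ)) (k : ℕ) :
    trunc r (sch.dilate μ hμ) w k = μ ^ 8 * trunc r sch (shrink μ w) k := by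
  let bare : SpeciesScheme (YMSpecies G) := { sch with c := fun _ _ => 1, m := fun _ _ => 0 }
  have h2 := latticeSchwinger_dilate r.ρ bare μ hμ (fun s => s.F) k (1 + 1) (fun _ => r.curvature)
    ![w, thetaTest 4 w]
  have h1 := latticeSchwinger_dilate r.ρ bare μ hμ (fun s => s.F) k 1 (fun _ => r.curvature) ![w]
  have h1' := latticeSchwinger_dilate r.ρ bare μ hμ (fun s => s.F) k 1 (fun _ => r.curvature)
    ![thetaTest 4 w]
  have e2 : (fun i => shrink μ (![w, thetaTest 4 w] i)) = ![shrink μ w, thetaTest 4 (shrink μ w)] := by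
    funext i; fin_cases i <;> simp [thetaTest_shrink]
  have e1 : (fun i => shrink μ (![w] i)) = ![shrink μ w] := by
    funext i; fin_cases i; simp
  have e1' : (fun i => shrink μ (![thetaTest 4 w] i)) = ![thetaTest 4 (shrink μ w)] := by
    funext i; fin_cases i; simp [thetaTest_shrink]
  rw [e2] at h2; rw [e1] at h1; rw [e1'] at h1'
  change latticeSchwinger r.ρ (bare.dilate μ hμ) _ k (1 + 1) _ _ -
      latticeSchwinger r.ρ (bare.dilate μ hμ) _ k 1 _ _ * latticeSchwinger r.ρ (bare.dilate μ hμ) _ k 1 _ _ = _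
  rw [h2, h1, h1']
  simp only [trunc]
  ring

end Sanity

end Summit.QuantumFields.YangMills.Cruxes.SelfNormalisedMomentBoundsR.ScaleLocal

end
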